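import Summits.HubbardSuperconductivity.HubbardSuperconductivity.Theorems.TwTipContinuation.Negative.TipNormalForm

/-!
# `TwTipContinuation` (stmt-HubbardSuperconductivity-1700) — CORNER TOOLS on sector energies (negative-side support)

Route `ThermalWedge`, crux rank 6. Companion of `Negative/TipNormalForm.lean` (normal form: the crux
is "lit at seed `1/20` ⇒ lit at seed `0`" for the every-GS d-wave order bound). The chords of
`Negative/SeededChords.lean` pin the every-GS order at a seed between left and right difference
quotients of the antitone, chord-concave sector-energy profile `g ↦ E_L(g)`; at the corner `g = 0` the
only LEFT chords sit at negative seeds (pair suppression). Consequences on the literal route terms: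

* `everyGSOrder_pure_of_suppressionCost` — positive tool: a linear energy COST `≥ c·η·L²` of a small
  REPULSIVE d-wave pair term `+(η/L²)ΔᴴΔ` (eventually, even `L`) gives the every-GS order bound of the
  pure torus, hence (TipNormalForm) the summit's conclusion at `(U,δ)`;
* `linearGain_of_everyGSOrder_pure` — every-GS order of the pure torus forces a LINEAR energy gain
  `E_L(0) − E_L(g) ≥ c g L²` from every attractive seed `g > 0`;
* `not_summitMatrix_of_sublinearGain` — the route's own ceiling mechanism as a refutation device:
  SUBLINEAR gain from small attractive seeds, frequently in even `L`, refutes the summit at `(U,δ)`.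

Why the Tip resists proof by bookkeeping: its premise lives at seeds `g ≥ 1/20` and bounds the corner
order from ABOVE only (right chords, monotonicity); nothing at `g > 0` bounds a left chord at `0`
(`Negative/AbstractTipShapeFalse.lean` makes this a theorem for the abstract class). Folklore.
-/

noncomputable section

namespace Summit.HubbardSuperconductivity.TwTipContinuation.Negative

open Matrix Filter Finset
open Literature.MathematicalPhysics.QuantumLattice Literature.Probability.LatticeModels
open Summit.HubbardSuperconductivity.HubbardSuperconductivity.Theses.ThermalWedge
open scoped ComplexOrder

/-! ### Corner tools (sector energies of the seeded family) -/

/-- **Linear cost of pair SUPPRESSION ⇒ every-GS order of the pure torus.** If eventually (even `L`)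
some repulsive d-wave pair term `+(η/L²)ΔᴴΔ`, `η = η_L > 0`, raises the sector energy by at least
`c·η·L²`, the pure torus has the every-GS order bound (hence the summit at `(U,δ)`). Left chords at the
corner live at NEGATIVE seeds: this is the only side from which energies bound the corner order below. [folklore] -/
theorem everyGSOrder_pure_of_suppressionCost {U δ : ℝ}
    (h : ∃ c : ℝ, 0 < c ∧ ∃ L₀ : ℕ, ∀ (L : ℕ) [NeZero L], L₀ ≤ L → Even L →
      ∃ η : ℝ, 0 < η ∧ c * η * (L : ℝ) ^ 2 ≤
        (Matrix.minEnergyOn (hubbardTorus 2 L 1 U - (((-η) / (L : ℝ) ^ 2 : ℝ) : ℂ) • ((pairField dWaveFormFactor L)ᴴ * pairField dWaveFormFactor L)) (szSector (2 * ⌊(1 - δ) * (L : ℝ) ^ 2 / 2⌋₊) 0)) -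
        (Matrix.minEnergyOn (hubbardTorus 2 L 1 U - ((0 / (L : ℝ) ^ 2 : ℝ) : ℂ) • ((pairField dWaveFormFactor L)ᴴ * pairField dWaveFormFactor L)) (szSector (2 * ⌊(1 - δ) * (L : ℝ) ^ 2 / 2⌋₊) 0))) :
    (∃ c : ℝ, 0 < c ∧ ∃ L₀ : ℕ, ∀ (L : ℕ) [NeZero L], L₀ ≤ L → Even L →
        ∀ ψ : Fock (Orb (FermionTorus 2 L)), star ψ ⬝ᵥ ψ = 1 →
          IsGroundStateInSector (hubbardTorus 2 L 1 U) (2 * ⌊(1 - δ) * (L : ℝ) ^ 2 / 2⌋₊) 0 ψ →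
            c * (L : ℝ) ^ 4 ≤ (expect ((pairField dWaveFormFactor L)ᴴ * pairField dWaveFormFactor L) ψ).re) := by
  obtain ⟨c, hc, L₀, h⟩ := h
  refine (everyGSOrder_zero_iff (δ := δ)).1 ⟨c, hc, L₀, fun L _ hL₀ hE ψ hψ hgs => ?_⟩
  obtain ⟨η, hη, hcost⟩ := h L hL₀ hE
  have hl := leftChord_le_order (U := U) (g := 0) (g' := -η) (by linarith) hψ hgs
  have hL : (0 : ℝ) < (L : ℝ) ^ 2 := by
    have := NeZero.pos L
    positivity
  rw [sub_neg_eq_add, zero_add] at hl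
  have key := hcost.trans hl
  rw [div_mul_eq_mul_div, le_div_iff₀ hL] at key
  have : η * (c * (L : ℝ) ^ 4) ≤
      η * (expect ((pairField dWaveFormFactor L)ᴴ * pairField dWaveFormFactor L) ψ).re := by
    nlinarith
  exact le_of_mul_le_mul_left this hη

/-- **Every-GS order of the pure torus forces a LINEAR energy gain from any attractive seed**:
`c g L² ≤ E_L(0) − E_L(g)` for all `g > 0`, eventually in even `L`. [folklore] -/
theorem linearGain_of_everyGSOrder_pure {U δ : ℝ} (hδ : -1 ≤ δ)
    (h : (∃ c : ℝ, 0 < c ∧ ∃ L₀ : ℕ, ∀ (L : ℕ) [NeZero L], L₀ ≤ L → Even L →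
        ∀ ψ : Fock (Orb (FermionTorus 2 L)), star ψ ⬝ᵥ ψ = 1 →
          IsGroundStateInSector (hubbardTorus 2 L 1 U) (2 * ⌊(1 - δ) * (L : ℝ) ^ 2 / 2⌋₊) 0 ψ →
            c * (L : ℝ) ^ 4 ≤ (expect ((pairField dWaveFormFactor L)ᴴ * pairField dWaveFormFactor L) ψ).re)) :
    ∃ c : ℝ, 0 < c ∧ ∃ L₀ : ℕ, ∀ (L : ℕ) [NeZero L], L₀ ≤ L → Even L → ∀ g : ℝ, 0 < g →
      c * g * (L : ℝ) ^ 2 ≤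
        (Matrix.minEnergyOn (hubbardTorus 2 L 1 U - ((0 / (L : ℝ) ^ 2 : ℝ) : ℂ) • ((pairField dWaveFormFactor L)ᴴ * pairField dWaveFormFactor L)) (szSector (2 * ⌊(1 - δ) * (L : ℝ) ^ 2 / 2⌋₊) 0)) -
        (Matrix.minEnergyOn (hubbardTorus 2 L 1 U - ((g / (L : ℝ) ^ 2 : ℝ) : ℂ) • ((pairField dWaveFormFactor L)ᴴ * pairField dWaveFormFactor L)) (szSector (2 * ⌊(1 - δ) * (L : ℝ) ^ 2 / 2⌋₊) 0)) := by
  obtain ⟨c, hc, L₀, h⟩ := (everyGSOrder_zero_iff (δ := δ)).2 h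
  refine ⟨c, hc, L₀, fun L _ hL₀ hE g hg => ?_⟩
  have hn : ⌊(1 - δ) * (L : ℝ) ^ 2 / 2⌋₊ ≤ Fintype.card (FermionTorus 2 L) := by
    rw [Summit.HubbardSuperconductivity.NoGo.card_fermionTorus_two]
    exact Summit.HubbardSuperconductivity.NoGo.floor_pairNumber_le δ hδ L
  obtain ⟨ψ, hψ, hgs⟩ := exists_unit_groundState U 0 L hn
  have hb := h L hL₀ hE ψ hψ hgs
  have hr := order_le_rightChord hg hψ hgs
  have hL : (0 : ℝ) < (L : ℝ) ^ 2 := by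
    have := NeZero.pos L
    positivity
  have : (g - 0) / (L : ℝ) ^ 2 * (c * (L : ℝ) ^ 4) ≤
      (g - 0) / (L : ℝ) ^ 2 * (expect ((pairField dWaveFormFactor L)ᴴ * pairField dWaveFormFactor L) ψ).re :=
    mul_le_mul_of_nonneg_left hb (div_nonneg (by linarith) hL.le)
  have hid : (g - 0) / (L : ℝ) ^ 2 * (c * (L : ℝ) ^ 4) = c * g * (L : ℝ) ^ 2 := by
    rw [sub_zero]
    field_simp
  linarith

/-- **Corner refutation device (the route's ceiling mechanism)**: SUBLINEAR energy gain from small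
attractive d-wave seeds, frequently in even `L`, refutes the summit's conclusion at `(U,δ)`. [folklore] -/
theorem not_summitMatrix_of_sublinearGain {U δ : ℝ} (hδ : -1 ≤ δ)
    (h : ∀ c : ℝ, 0 < c → ∀ L₀ : ℕ, ∃ (L : ℕ) (_ : NeZero L), L₀ ≤ L ∧ Even L ∧ ∃ g : ℝ, 0 < g ∧
      (Matrix.minEnergyOn (hubbardTorus 2 L 1 U - ((0 / (L : ℝ) ^ 2 : ℝ) : ℂ) • ((pairField dWaveFormFactor L)ᴴ * pairField dWaveFormFactor L)) (szSector (2 * ⌊(1 - δ) * (L : ℝ) ^ 2 / 2⌋₊) 0)) -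
        (Matrix.minEnergyOn (hubbardTorus 2 L 1 U - ((g / (L : ℝ) ^ 2 : ℝ) : ℂ) • ((pairField dWaveFormFactor L)ᴴ * pairField dWaveFormFactor L)) (szSector (2 * ⌊(1 - δ) * (L : ℝ) ^ 2 / 2⌋₊) 0)) <
        c * g * (L : ℝ) ^ 2) :
    ¬ (∀ (N : ℕ → ℕ) (ψ : ∀ L, Fock (Orb (FermionTorus 2 L))),
        (∀ L, Even L → N L = 2 * ⌊(1 - δ) * (L : ℝ) ^ 2 / 2⌋₊ ∧ star (ψ L) ⬝ᵥ ψ L = 1 ∧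
            IsGroundStateInSector (hubbardTorus 2 L 1 U) (N L) 0 (ψ L)) →
          HasLongRangeOrder (fun k => halfOpenBox 2 (2 * k))
            (fun k => torusPullback (pairFieldCorr dWaveFormFactor ψ) (2 * k))) := by
  intro hS
  obtain ⟨c, hc, L₀, hlin⟩ := linearGain_of_everyGSOrder_pure hδ (everyGSOrder_of_summitMatrix hδ hS)
  obtain ⟨L, _, hL₀, hE, g, hg, hlt⟩ := h c hc L₀
  have := hlin L hL₀ hE g hg
  linarith

end Summit.HubbardSuperconductivity.TwTipContinuation.Negative
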